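import Literature.Computability.Complexity.NegationLimited
import Literature.Computability.Complexity.CircuitLowerBounds
import HarnessLib

/-!
# Amano–Maruoka: CLIQUE with `(1/6) log log n` negations needs superpolynomial size

Named fact (D-0014) requested by route PneNP/NegLimited, crux #3 (`wi-03883`), stated over
`Literature.Computability.Complexity.cliqueFn` (edge-indicator inputs of `K_m`), `deMorganBasis = {∧₂, ∨₂, ¬}` and
`Circuit.negationCount` (`NegationLimited.lean`).

Amano and Maruoka (MFCS 1998; SIAM J. Comput. 35 (2005) 201–216, main theorem) prove that for a
suitable clique size `s = s(m)` every circuit over `{∧, ∨, ¬}` with at most `(1/6) log log`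
(input length) NOT gates computing `CLIQUE(m, s)` has superpolynomial size; Jukna (2012, §10.5)
records this as "`CLIQUE ∉ P(r)` even for `r = (1/6) log log n`", where `P(r)` is the class of
function sequences computable by polynomial-size circuits with at most `r` NOT gates.

## Faithfulness (the fact is not stronger than the source)

* The clique size is quantified EXISTENTIALLY (`∃ s : ℕ → ℕ` with `2 ≤ s m ≤ m` eventually): the
  printed theorem fixes a specific polylogarithmic-type `s(m)`, which we do not transcribe.
* The negation budget is `⌊log₂ (log₂ m) / 6⌋` with `m` the number of VERTICES; since
  `m ≤ (m choose 2)` for `m ≥ 3` this is at most the printed `(1/6) log log n` whether `n` there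
  denotes vertices or input bits, so our hypothesis on the circuit is at least as restrictive.
* "Superpolynomial" is rendered as: for every exponent `k`, for all large `m`, every such circuit
  has more than `m ^ k` gates (polynomial in `m` iff polynomial in the input length `m choose 2`);
  this follows from the explicit bound of the paper holding for all large `m`.

## References

* K. Amano, A. Maruoka, *A superpolynomial lower bound for a circuit computing the clique
  function with at most (1/6) log log n negation gates*, SIAM J. Comput. 35 (2005) 201–216
  (conference version MFCS 1998, LNCS 1450) [AmanoMaruoka2005].
* S. Jukna, *Boolean Function Complexity* (2012), §10.5 [Jukna2012].
-/

namespace Literature.Computability.Complexity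

open Filter

/-- The Amano–Maruoka negation budget `⌊(1/6) log₂ log₂ m⌋` (in terms of the number `m` of
vertices). [Amano–Maruoka 2005, §1; Jukna 2012, §10.5] [folklore] -/
noncomputable def amanoMaruokaBudget (m : ℕ) : ℕ := Nat.log 2 (Nat.log 2 m) / 6

/-- **Amano–Maruoka (2005).** There is a clique-size sequence `s(m)` (`2 ≤ s m ≤ m` for large `m`)
such that circuits over the De Morgan basis `{∧₂, ∨₂, ¬}` with at most `⌊(1/6) log₂ log₂ m⌋` NOT
gates computing `CLIQUE(m, s m)` have superpolynomial size: for every `k`, for all large `m`,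
every such circuit has at least `m ^ k` gates. See the module docstring for why this is at most
as strong as the printed theorem. [cite: AmanoMaruoka2005, §1 main theorem] -/
def amano_maruoka : Prop :=
  ∃ s : ℕ → ℕ, (∀ᶠ m in atTop, 2 ≤ s m ∧ s m ≤ m) ∧
    ∀ k : ℕ, ∀ᶠ m in atTop,
      ∀ C : Circuit ((⊤ : SimpleGraph (Fin m)).edgeSet), C.IsOver deMorganBasis →
        C.Computes (Complexity.cliqueFn m (s m)) → C.negationCount ≤ amanoMaruokaBudget m → m ^ k ≤ C.size

/-- In particular (taking circuits with NO negations, budget `≥ 0`), Amano–Maruoka contains a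
superpolynomial MONOTONE lower bound for `CLIQUE(m, s m)` over `{∧₂, ∨₂}` ⊆ De Morgan basis.
[folklore] -/
theorem amano_maruoka.monotone (h : amano_maruoka) :
    ∃ s : ℕ → ℕ, (∀ᶠ m in atTop, 2 ≤ s m ∧ s m ≤ m) ∧
      ∀ k : ℕ, ∀ᶠ m in atTop,
        ∀ C : Circuit ((⊤ : SimpleGraph (Fin m)).edgeSet), C.IsOver monotoneBasis →
          C.Computes (Complexity.cliqueFn m (s m)) → m ^ k ≤ C.size := by
  obtain ⟨s, hs, h⟩ := h
  exact ⟨s, hs, fun k => (h k).mono fun m hm C hB hf =>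
    hm C (hB.mono monotoneBasis_subset_deMorgan) hf
      ((Circuit.negationCount_eq_zero_of_isOver_monotoneBasis hB).le.trans (Nat.zero_le _))⟩

end Literature.Computability.Complexity
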